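import Literature.NumberTheory.Automorphic.UnitaryGroupArchimedeanPlaces
import Literature.GroupTheory.ArithmeticGroups.UnitaryRealApproximationCMDense
import Literature.GroupTheory.ArithmeticGroups.UnitaryRealApproximationGL
import HarnessLib

/-!
# Real approximation for `U(H)` over a CM field in the `U2` vocabulary: the hypothesis `hWA` discharged

Registry: pub-hodgecm MODEL-CONSTRUCTION sub-cell, MODEL-DAG node **U2** (vi) / AX2 registry row **N-D5**
(`BallFacts.dense`, C4). Topic `NumberTheory/Automorphic`; namespace `Literature.NumberTheory.Automorphic.UnitaryGroup`.
Everything here is PROVED (kernel; no named fact, no record).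

The U2 file `UnitaryGroupArchimedeanPlaces` transfers real approximation to a single archimedean place
(`denseRange_rationalToArchLocal`, `denseRange_rationalToArchLocal_cm`) UNDER the explicit hypothesis
`hWA : DenseRange (rationalToArch F E c N J)` — weak approximation at the archimedean places for `U(J)`
(Platonov–Rapinchuk 1994 §7.1 Thm. 7.7 p. 415; Kneser; Sansuc 1981 Cor. 3.5), left there as a binder. For a CM field
`L` (`F = L⁺`, `E = L`, `c` = complex conjugation) and a non-degenerate hermitian `H ∈ M_N(L)` (`ᵗ(c H) = H`,
`det H ≠ 0`) that hypothesis is a THEOREM of the tree: `GroupTheory/ArithmeticGroups/UnitaryRealApproximationCM`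
proves, by Cayley's method, that the joint archimedean image of `U(H)(L⁺) = {g ∈ M_N(L) : ᵗ(c g) H g = H}` is dense in
`∏_{w ∣ ∞} U(H^w)` (`RealApproximationCM.unitary_realApproximation`). This file is the bridge between the two
vocabularies:

* §1 `archLocalPiCoe : Π_w U(σ_w H)(ℂ) → Π_w M_N(ℂ)` is a topological embedding (`isEmbedding_archLocalPiCoe`, from the
  tree's `RealApproximation.isEmbedding_coe_GL`: `GL_N(ℂ) → M_N(ℂ)` is an embedding), so closures in `Π_w U(σ_w H)(ℂ)` are
  computed on matrices;
* §2 **`denseRange_rationalToArchLocalPi`** — the joint map `U(H)(L⁺) → Π_{w complex} U(σ_w H)(ℂ)`, `g ↦ (σ_w g)_w`, has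
  dense range; **`denseRange_rationalToArch_cm`** — `DenseRange (rationalToArch L⁺ L c N H)`, i.e. the U2 hypothesis
  `hWA` HOLDS (transport along U2's `archPiEquivCM : U(H)(L ⊗ ℝ) ≃ₜ* Π_w U(σ_w H)(ℂ)`); and the one-place corollary with
  `hWA` discharged, **`denseRange_rationalToArchLocal_of_hermitian`** — `σ_w(U(H)(L⁺))` is dense in `U(σ_w H)(ℂ)` for
  every complex place `w` (the `U(2,1)` factor of a Picard datum: "`U(H)(L⁺)` is dense in `U(2,1)`").

Not here: non-hermitian or degenerate `J` (the U2 objects are defined for any matrix `J`, but `U(J)` is then not the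
unitary group of a hermitian space and real approximation is not claimed); fields other than CM fields; finite places.

## References

* V. Platonov, A. Rapinchuk, *Algebraic Groups and Number Theory*, Academic Press 1994, §7.1 Thm. 7.7 p. 415
  ("`G(K)` is dense in `G_∞`" for connected `G`). [PlatonovRapinchuk1994]
* J. R. Getz, H. Hahn, *An Introduction to Automorphic Representations*, GTM 300, Springer 2024, §2.5 Def. 2.9,
  Thm. 2.5.2. [GetzHahn2024]
* A. Borel, H. Jacquet, *Automorphic forms and automorphic representations*, Proc. Sympos. Pure Math. 33 (1979),
  part 1, 189–202, §4.1. [BorelJacquet1979]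
-/

noncomputable section

open NumberField NumberField.InfinitePlace Topology

open scoped Matrix MatrixGroups ComplexConjugate

namespace Literature.NumberTheory.Automorphic

namespace UnitaryGroup

/-! ## 1. Closures in `Π_w U(σ_w H)(ℂ)` are computed on matrices -/

section Embedding

variable (N : ℕ)

variable (E : Type) [Field E] [NumberField E] (J : Matrix (Fin N) (Fin N) E)

/-- The coordinate map `Π_w U(σ_w J)(ℂ) → Π_w M_N(ℂ)` (underlying matrices, complex places `w`). [folklore] -/
def archLocalPiCoe (u : ∀ w : {w : InfinitePlace E // IsComplex w}, archLocal E N J w) :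
    {w : InfinitePlace E // IsComplex w} → Matrix (Fin N) (Fin N) ℂ :=
  fun w => ((u w : GL (Fin N) ℂ) : Matrix (Fin N) (Fin N) ℂ)

omit [NumberField E] in
/-- Components of `archLocalPiCoe`. [folklore] -/
@[simp] theorem archLocalPiCoe_apply (u : ∀ w : {w : InfinitePlace E // IsComplex w}, archLocal E N J w)
    (w : {w : InfinitePlace E // IsComplex w}) :
    archLocalPiCoe N E J u w = ((u w : GL (Fin N) ℂ) : Matrix (Fin N) (Fin N) ℂ) := rfl

omit [NumberField E] in
/-- **`Π_w U(σ_w J)(ℂ) → Π_w M_N(ℂ)` is a topological embedding** (product of the embeddings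
`U(σ_w J)(ℂ) ↪ GL_N(ℂ) ↪ M_N(ℂ)`; the second one is the tree's `RealApproximation.isEmbedding_coe_GL`: Mathlib topologises
`GL_N(ℂ) = M_N(ℂ)ˣ` through `g ↦ (g, g⁻¹)`, and inversion is continuous on the invertible matrices), so closures in
`Π_w U(σ_w J)(ℂ)` are computed on matrices. [folklore] -/
theorem isEmbedding_archLocalPiCoe : IsEmbedding (archLocalPiCoe N E J) :=
  IsEmbedding.piMap
    (f := fun (w : {w : InfinitePlace E // IsComplex w}) (u : archLocal E N J w) =>
      ((u : GL (Fin N) ℂ) : Matrix (Fin N) (Fin N) ℂ))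
    fun _ => Literature.GroupTheory.ArithmeticGroups.RealApproximation.isEmbedding_coe_GL.comp IsEmbedding.subtypeVal

end Embedding

/-! ## 2. Real approximation for `U(H)`, `H` hermitian non-degenerate over a CM field -/

section CM

variable (N : ℕ) (L : Type) [Field L] [NumberField L] [IsCMField L] (H : Matrix (Fin N) (Fin N) L)

open Literature.GroupTheory.ArithmeticGroups.RealApproximationCM in
/-- **Real approximation for `U(H)`, joint form in the U2 vocabulary**: for a CM field `L` and a non-degenerate
hermitian `H ∈ M_N(L)`, the joint map `U(H)(L⁺) → Π_{w} U(σ_w H)(ℂ)`, `g ↦ (σ_w(g))_w` over the (complex) infinite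
places `w` of `L`, has dense range. Proof: closures in `Π_w U(σ_w H)(ℂ)` are computed on matrices (§1), where this is
the tree theorem `RealApproximationCM.unitary_realApproximation` (Cayley's method) projected from all infinite places
of `L` (all complex, `L` being CM) to the subtype of complex places. Platonov–Rapinchuk Thm. 7.7 for `G = U(H)`,
`S = V_∞` — here a theorem, the citation is provenance. [cite: PlatonovRapinchuk1994, §7.1 Thm 7.7] -/
theorem denseRange_rationalToArchLocalPi (hH : (H.map (IsCMField.complexConj L))ᵀ = H) (hdet : IsUnit H.det) :
    DenseRange (fun g : rational (↥(maximalRealSubfield L)) L (IsCMField.complexConj L) N H =>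
      fun w : {w : InfinitePlace L // IsComplex w} =>
        rationalToArchLocal (↥(maximalRealSubfield L)) L (IsCMField.complexConj L) N H w
          (complexConj_smul_infinitePlace L w.1) (IsCMField.complexConj_ne_one L) g) := by
  classical
  set Φ := fun g : rational (↥(maximalRealSubfield L)) L (IsCMField.complexConj L) N H =>
      fun w : {w : InfinitePlace L // IsComplex w} =>
        rationalToArchLocal (↥(maximalRealSubfield L)) L (IsCMField.complexConj L) N H w
          (complexConj_smul_infinitePlace L w.1) (IsCMField.complexConj_ne_one L) g with hΦ
  intro u
  rw [(isEmbedding_archLocalPiCoe N L H).isInducing.closure_eq_preimage_closure_image, Set.mem_preimage]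
  -- the family over ALL infinite places of `L` (each of them complex)
  have hcx : ∀ w : InfinitePlace L, IsComplex w := fun w => IsTotallyComplex.isComplex w
  set U : InfinitePlace L → Matrix (Fin N) (Fin N) ℂ :=
    fun w => ((u ⟨w, hcx w⟩ : GL (Fin N) ℂ) : Matrix (Fin N) (Fin N) ℂ) with hU
  have hUmem : ∀ w, (U w)ᴴ * H.map w.embedding * U w = H.map w.embedding := fun w =>
    (mem_archLocal_iff_conjTranspose L N H ⟨w, hcx w⟩ _).1 (u ⟨w, hcx w⟩).2
  have hclo := unitary_realApproximation L H hH hdet U hUmem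
  -- project to the subtype of complex places
  have hP : Continuous fun (x : InfinitePlace L → Matrix (Fin N) (Fin N) ℂ)
      (w : {w : InfinitePlace L // IsComplex w}) => x w.1 :=
    continuous_pi fun w => continuous_apply w.1
  have hPU : (fun w : {w : InfinitePlace L // IsComplex w} => U w.1) = archLocalPiCoe N L H u := by
    funext w
    rfl
  rw [← hPU]
  refine map_mem_closure hP hclo ?_
  rintro x ⟨g, hg, rfl⟩
  have hg0 : g.det ≠ 0 := det_ne_zero_of_mem_unitarySet L H hdet hg
  refine ⟨Φ ⟨Matrix.GeneralLinearGroup.mkOfDetNeZero g hg0, hg⟩, Set.mem_range_self _, ?_⟩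
  funext w
  rfl

/-- **Real approximation for `U(H)` — the U2 hypothesis `hWA` discharged**: for a CM field `L` and a non-degenerate
hermitian `H ∈ M_N(L)`, `U(H)(L⁺)` is dense in `U(H)(L ⊗ ℝ) = ∏_{v ∣ ∞} U(H)(L⁺_v)`, i.e.
`DenseRange (rationalToArch L⁺ L c N H)` (transport of `denseRange_rationalToArchLocalPi` along U2's
`archPiEquivCM : U(H)(L ⊗ ℝ) ≃ₜ* Π_w U(σ_w H)(ℂ)`, whose components are `archAt_rationalToArch : (g ⊗ 1)_w = σ_w(g)`).
Platonov–Rapinchuk Thm. 7.7 / Getz–Hahn Thm. 2.5.2 for `G = U(H)`, `S = V_∞`; here a theorem.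
[cite: PlatonovRapinchuk1994, §7.1 Thm 7.7] -/
theorem denseRange_rationalToArch_cm (hH : (H.map (IsCMField.complexConj L))ᵀ = H) (hdet : IsUnit H.det) :
    DenseRange (rationalToArch (↥(maximalRealSubfield L)) L (IsCMField.complexConj L) N H) := by
  have h := denseRange_rationalToArchLocalPi N L H hH hdet
  set Ψ := archPiEquivCM N L H with hΨ
  have hcomp : (fun g : rational (↥(maximalRealSubfield L)) L (IsCMField.complexConj L) N H =>
      fun w : {w : InfinitePlace L // IsComplex w} =>
        rationalToArchLocal (↥(maximalRealSubfield L)) L (IsCMField.complexConj L) N H w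
          (complexConj_smul_infinitePlace L w.1) (IsCMField.complexConj_ne_one L) g) =
      Ψ ∘ rationalToArch (↥(maximalRealSubfield L)) L (IsCMField.complexConj L) N H := by
    funext g w
    exact (archAt_rationalToArch (↥(maximalRealSubfield L)) L (IsCMField.complexConj L) N H w
      (complexConj_smul_infinitePlace L w.1) (IsCMField.complexConj_ne_one L) g).symm
  rw [hcomp] at h
  have hfac : (rationalToArch (↥(maximalRealSubfield L)) L (IsCMField.complexConj L) N H :
      rational (↥(maximalRealSubfield L)) L (IsCMField.complexConj L) N H →
        arch (↥(maximalRealSubfield L)) L (IsCMField.complexConj L) N H) =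
      Ψ.symm ∘ (Ψ ∘ rationalToArch (↥(maximalRealSubfield L)) L (IsCMField.complexConj L) N H) := by
    funext g
    simp only [Function.comp_apply, ContinuousMulEquiv.symm_apply_apply]
  rw [hfac]
  have hsurj : Function.Surjective Ψ.symm := fun g => ⟨Ψ g, Ψ.symm_apply_apply g⟩
  exact hsurj.denseRange.comp h Ψ.symm.continuous

/-- **One complex place, `hWA` discharged**: for a CM field `L`, a non-degenerate hermitian `H ∈ M_N(L)` and any
complex place `w` of `L`, the image `σ_w(U(H)(L⁺))` is dense in the factor `U(σ_w H)(ℂ)` of `U(H)(L ⊗ ℝ)` (U2's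
`denseRange_rationalToArchLocal_cm` with its weak-approximation hypothesis supplied by `denseRange_rationalToArch_cm`).
For a hermitian space of signature `(2,1)` at `w` and definite elsewhere: `U(H)(L⁺)` is dense in `U(2,1)`.
[cite: PlatonovRapinchuk1994, §7.1 Thm 7.7] -/
theorem denseRange_rationalToArchLocal_of_hermitian (hH : (H.map (IsCMField.complexConj L))ᵀ = H)
    (hdet : IsUnit H.det) (w : {w : InfinitePlace L // IsComplex w}) :
    DenseRange (rationalToArchLocal (↥(maximalRealSubfield L)) L (IsCMField.complexConj L) N H w
      (complexConj_smul_infinitePlace L w.1) (IsCMField.complexConj_ne_one L)) :=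
  denseRange_rationalToArchLocal_cm N L H (denseRange_rationalToArch_cm N L H hH hdet) w

end CM

end UnitaryGroup

end Literature.NumberTheory.Automorphic

end
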